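import Mathlib.Analysis.Convex.PathConnected
import Mathlib.Analysis.Convex.Topology
import Mathlib.Analysis.Normed.Affine.AddTorsor
import Mathlib.Algebra.Order.Floor.Defs
import Literature.Geometry.Lorentzian.Basic
import HarnessLib

/-!
# Crux `GapExhaustion` (stmt-FinalStateConjecture-10808), line `photon-shell-pseudoconvexity`:
# stub (S-3) `stub_levelSweep` — the ABSTRACT LEVEL-SET SWEEP (globalisation of a uniform local
# extension property across the level sets of a function with convex sublevel sets)

Route `BartnikGapSettling`; helper (`--supports stmt-FinalStateConjecture-10808`) of line lead c9
(§1g SWEEP). The three sweeps of the line's rigidity node (S3 inward, S5 outward, S6b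
`T`-conditional; Ionescu–Klainerman, JAMS 26 (2013) Thm 1.2 / Surveys Diff. Geom. 20 (2015)
Thm 2.4, as globalised in Alexakis–Ionescu–Klainerman, CMP 299 (2010) §§5–6) all have the shape:
a Killing field given on the sublevel region `{f < c₀}` of the Kerr–Schild radius `f = r` is
extended across the level cylinders `{f = c}`, `c ∈ [c₀, c₁]`, by a LOCAL extension theorem with
a UNIFORM radius, the local extensions being patched by unique continuation. This file isolates
the purely topological half of that argument, with the analytic input abstracted into a predicate
`P k U` ("`k` is an admissible — e.g. Killing — field on the open set `U`") subject to four
axioms (restriction, locality, gluing over open covers, unique continuation on connected opens),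
and the geometry of `f` abstracted into: convex closed sublevel sets on the band, density of the
strict sublevel set up to the level set, and a linear covering estimate (every point `y` of the
arena above level `c` is within `C (f y − c)` of the level set). Under a uniform local extension
hypothesis across every level `c ∈ [c₀, c₁]` (input radius `ρ`, output radius `ρ'`), a field
admissible on `D ∩ {f < c₀}` extends to one admissible on `D ∩ {f < c₁}` (`stub_levelSweep`).
The Kerr-radius instances of the three geometric hypotheses are the sibling stubs (S-1)
`stub_kerrRadius_sublevel_convex` and (S-2) `stub_kerrRadius_bandCover`; the four axioms for
coordinate / manifold Killing fields are §1e (`killingPatching`, `stub_isKillingFieldOn_patching`)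
plus the sheaf property of the Killing equation.

Proof: one step `c ↦ c + σ`, `σ = ρ'/(2C)`: choose a local extension `k_x` on `ball x ρ'` at
every point `x` of the level set; two of them agree on the lens `ball x ρ' ∩ ball x' ρ'` (convex,
hence connected; it contains the midpoint of `x, x'`, which lies in the convex set `{f ≤ c}`,
hence — the lens being open and `{f ≤ c} ⊆ closure {f < c}` — the lens meets `{f < c}`, where
both fields equal the old one; unique continuation); glue by a pointwise `if`; the glued field is
admissible on the old region and on every ball (locality), hence on the union (gluing), which
contains `D ∩ {f < c + σ}` (covering estimate). Then induct on `⌊(c₁ − c₀)/σ⌋` steps. Pure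
topology over `E4`; no geometry is used. [folklore globalisation argument; cf.
Alexakis–Ionescu–Klainerman, CMP 299 (2010), §6]
-/

noncomputable section

-- D-0017: single-problem summit, `Summit.<S>.<S>.…` by design (cf. lakefile `weak.linter.dupNamespace`).
set_option linter.dupNamespace false

namespace Summit.FinalStateConjecture.FinalStateConjecture.Theorems

open Set Metric
open Literature.Geometry.Lorentzian

/-- **One step of the level-set sweep.** Under the four axioms on `P` (restriction, locality,
gluing over open covers, unique continuation on connected opens), the three geometric hypotheses
on `f` at the level `c` (convexity of `{f ≤ c}`, density `{f ≤ c} ⊆ closure {f < c}`, linear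
covering estimate above `c`), and the uniform local extension property across `{f = c}` (input
radius `ρ`, output radius `ρ'`, the `ρ`-balls around level points lying in the arena `D`),
a field admissible on `D ∩ {f < c}` extends to a field admissible on `D ∩ {f < c + ρ'/(2C)}`
agreeing with it on `D ∩ {f < c}`. [folklore] -/
theorem levelSweep_step (β : Type) (P : (E4 → β) → Set E4 → Prop) (f : E4 → ℝ) (D : Set E4)
    (c ρ ρ' C : ℝ)
    (hmono : ∀ (k : E4 → β) (U V : Set E4), P k U → V ⊆ U → P k V)
    (hcongr : ∀ (k k' : E4 → β) (U : Set E4), IsOpen U → EqOn k k' U → P k U → P k' U)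
    (hunion : ∀ (k : E4 → β) (ι : Type) (U : ι → Set E4), (∀ i, IsOpen (U i)) →
      (∀ i, P k (U i)) → P k (⋃ i, U i))
    (hpatch : ∀ (k₁ k₂ : E4 → β) (U V : Set E4), IsOpen V → IsConnected V → IsOpen U → U ⊆ V →
      U.Nonempty → P k₁ V → P k₂ V → EqOn k₁ k₂ U → EqOn k₁ k₂ V)
    (hf : Continuous f) (hD : IsOpen D) (hρ' : 0 < ρ') (hC : 0 < C)
    (hconv : Convex ℝ {x | f x ≤ c}) (hdense : {x | f x ≤ c} ⊆ closure {x | f x < c})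
    (hcover : ∀ y ∈ D, c ≤ f y → ∃ x, f x = c ∧ ‖x - y‖ ≤ C * (f y - c))
    (hball : ∀ x, f x = c → ball x ρ ⊆ D)
    (hloc : ∀ x, f x = c → ∀ k : E4 → β, P k (ball x ρ ∩ {y | f y < c}) →
      ∃ k' : E4 → β, P k' (ball x ρ') ∧ EqOn k' k (ball x ρ' ∩ {y | f y < c}))
    (k : E4 → β) (hk : P k (D ∩ {y | f y < c})) :
    ∃ k' : E4 → β, P k' (D ∩ {y | f y < c + ρ' / (2 * C)}) ∧ EqOn k' k (D ∩ {y | f y < c}) := by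
  have hlt : IsOpen {y : E4 | f y < c} := isOpen_lt hf continuous_const
  -- local extensions at every level point
  have hloc' : ∀ x : {x : E4 // f x = c}, ∃ k' : E4 → β, P k' (ball x.1 ρ') ∧
      EqOn k' k (ball x.1 ρ' ∩ {y | f y < c}) := fun x ↦
    hloc x.1 x.2 k (hmono k _ _ hk fun y hy ↦ ⟨hball x.1 x.2 hy.1, hy.2⟩)
  choose kx hkxP hkxeq using hloc'
  -- two local extensions agree on the lens of their balls
  have hpair : ∀ x x' : {x : E4 // f x = c}, EqOn (kx x) (kx x') (ball x.1 ρ' ∩ ball x'.1 ρ') := by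
    intro x x'
    set V : Set E4 := ball x.1 ρ' ∩ ball x'.1 ρ' with hV
    rcases V.eq_empty_or_nonempty with hVe | ⟨y₀, hy₀⟩
    · rw [hVe]
      exact fun _ h ↦ h.elim
    have hVo : IsOpen V := isOpen_ball.inter isOpen_ball
    have hVc : IsConnected V := ((convex_ball x.1 ρ').inter (convex_ball x'.1 ρ')).isConnected ⟨y₀, hy₀⟩
    -- the midpoint of `x, x'` lies in the lens and in the convex set `{f ≤ c}`
    set q : E4 := midpoint ℝ x.1 x'.1 with hq
    have hxx' : dist x.1 x'.1 < ρ' + ρ' :=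
      (dist_triangle x.1 y₀ x'.1).trans_lt (add_lt_add (mem_ball'.1 hy₀.1) (mem_ball.1 hy₀.2))
    have hqV : q ∈ V := by
      refine ⟨mem_ball.2 ?_, mem_ball.2 ?_⟩
      · rw [hq, dist_midpoint_left (𝕜 := ℝ)]
        have h2 : ‖(2 : ℝ)‖⁻¹ = 1 / 2 := by norm_num
        rw [h2]
        linarith
      · rw [hq, dist_midpoint_right (𝕜 := ℝ)]
        have h2 : ‖(2 : ℝ)‖⁻¹ = 1 / 2 := by norm_num
        rw [h2]
        linarith
    have hqle : q ∈ {y : E4 | f y ≤ c} := by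
      have hseg : q ∈ segment ℝ x.1 x'.1 := by
        rw [hq]
        exact midpoint_mem_segment x.1 x'.1
      exact hconv.segment_subset (by simp [x.2]) (by simp [x'.2]) hseg
    -- hence the lens meets `{f < c}`
    have hUne : (V ∩ {y | f y < c}).Nonempty := by
      have hqcl : q ∈ closure {y : E4 | f y < c} := hdense hqle
      obtain ⟨y, hyV, hy⟩ := mem_closure_iff.1 hqcl V hVo hqV
      exact ⟨y, hyV, hy⟩
    refine hpatch (kx x) (kx x') (V ∩ {y | f y < c}) V hVo hVc (hVo.inter hlt) inter_subset_left
      hUne (hmono _ _ _ (hkxP x) inter_subset_left) (hmono _ _ _ (hkxP x') inter_subset_right) ?_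
    intro y hy
    rw [hkxeq x ⟨hy.1.1, hy.2⟩, hkxeq x' ⟨hy.1.2, hy.2⟩]
  -- the glued field
  classical
  let k' : E4 → β := fun y ↦
    if h : ∃ x : {x : E4 // f x = c}, y ∈ ball x.1 ρ' then kx h.choose y else k y
  have hk'ball : ∀ x : {x : E4 // f x = c}, EqOn k' (kx x) (ball x.1 ρ') := by
    intro x y hy
    have h : ∃ x : {x : E4 // f x = c}, y ∈ ball x.1 ρ' := ⟨x, hy⟩
    simp only [k', dif_pos h]
    exact hpair h.choose x ⟨h.choose_spec, hy⟩
  have hk'old : EqOn k' k {y | f y < c} := by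
    intro y hy
    by_cases h : ∃ x : {x : E4 // f x = c}, y ∈ ball x.1 ρ'
    · simp only [k', dif_pos h]
      exact hkxeq h.choose ⟨h.choose_spec, hy⟩
    · simp only [k', dif_neg h]
  -- admissibility of the glued field on the old region and on every ball, hence on the union
  have hP₁ : P k' (D ∩ {y | f y < c}) :=
    hcongr k k' _ (hD.inter hlt) (fun y hy ↦ (hk'old hy.2).symm) hk
  have hP₂ : ∀ x : {x : E4 // f x = c}, P k' (ball x.1 ρ') := fun x ↦
    hcongr (kx x) k' _ isOpen_ball (fun y hy ↦ (hk'ball x hy).symm) (hkxP x)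
  let U : Option {x : E4 // f x = c} → Set E4 := fun o ↦
    match o with
    | none => D ∩ {y | f y < c}
    | some x => ball x.1 ρ'
  have hUopen : ∀ o, IsOpen (U o) := by
    rintro (_ | x)
    · exact hD.inter hlt
    · exact isOpen_ball
  have hUP : ∀ o, P k' (U o) := by
    rintro (_ | x)
    · exact hP₁
    · exact hP₂ x
  have hPU : P k' (⋃ o, U o) := hunion k' _ U hUopen hUP
  -- the union contains the next sublevel region
  have hsub : D ∩ {y | f y < c + ρ' / (2 * C)} ⊆ ⋃ o, U o := by
    intro y hy
    rcases lt_or_ge (f y) c with hlt' | hge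
    · exact mem_iUnion.2 ⟨none, hy.1, hlt'⟩
    · obtain ⟨x, hx, hxy⟩ := hcover y hy.1 hge
      refine mem_iUnion.2 ⟨some ⟨x, hx⟩, ?_⟩
      show y ∈ ball x ρ'
      rw [mem_ball, dist_comm, dist_eq_norm]
      have h0 : f y < c + ρ' / (2 * C) := hy.2
      have h1 : f y - c < ρ' / (2 * C) := by linarith
      have h2 : C * (f y - c) < C * (ρ' / (2 * C)) := mul_lt_mul_of_pos_left h1 hC
      have h3 : C * (ρ' / (2 * C)) = ρ' / 2 := by field_simp
      linarith
  exact ⟨k', hmono _ _ _ hPU hsub, fun y hy ↦ hk'old hy.2⟩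

/-- **Stub (S-3) of the line `photon-shell-pseudoconvexity` (crux `GapExhaustion`,
stmt-FinalStateConjecture-10808) — the abstract level-set sweep.** Let `P k U` be a predicate on
fields `k : E4 → β` and sets `U ⊆ E4` which is monotone under restriction, local (invariant
under changing `k` off the open set `U`), glues over arbitrary open covers, and has unique
continuation on connected open sets (two `P`-fields on a connected open `V` agreeing on a
nonempty open `U ⊆ V` agree on `V`). Let `f` be continuous with convex sublevel sets `{f ≤ c}`
and `{f ≤ c} ⊆ closure {f < c}` for `c ∈ [c₀, c₁]`, let `D` be an open arena in which every
point `y` above level `c` is within `C (f y − c)` of the level set `{f = c}`, and suppose the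
UNIFORM LOCAL EXTENSION property across every level `c ∈ [c₀, c₁]`: for every `x` with
`f x = c`, `ball x ρ ⊆ D`, and every `P`-field on the half-ball `ball x ρ ∩ {f < c}` is extended
by a `P`-field on `ball x ρ'` (`0 < ρ'`) agreeing with it on the half-ball. Then every `P`-field on `D ∩ {f < c₀}` is extended
by a `P`-field on `D ∩ {f < c₁}`. This is the topological half of the globalisation of the
Ionescu–Klainerman local Killing-extension theorems over the foliation by Kerr–Schild cylinders
(the line's sweeps S3/S5/S6b); its geometric hypotheses for `f = Kerr.radius a` are the sibling
stubs (S-1)/(S-2), its four axioms for Killing fields are §1e. [folklore; cf.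
Alexakis–Ionescu–Klainerman, CMP 299 (2010), §6] -/
theorem stub_levelSweep :
    ∀ (β : Type) (P : (E4 → β) → Set E4 → Prop) (f : E4 → ℝ) (D : Set E4) (c₀ c₁ ρ ρ' C : ℝ)
      (k₀ : E4 → β),
      (∀ (k : E4 → β) (U V : Set E4), P k U → V ⊆ U → P k V) →
      (∀ (k k' : E4 → β) (U : Set E4), IsOpen U → EqOn k k' U → P k U → P k' U) →
      (∀ (k : E4 → β) (ι : Type) (U : ι → Set E4), (∀ i, IsOpen (U i)) →
        (∀ i, P k (U i)) → P k (⋃ i, U i)) →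
      (∀ (k₁ k₂ : E4 → β) (U V : Set E4), IsOpen V → IsConnected V → IsOpen U → U ⊆ V →
        U.Nonempty → P k₁ V → P k₂ V → EqOn k₁ k₂ U → EqOn k₁ k₂ V) →
      Continuous f → IsOpen D → c₀ ≤ c₁ → 0 < ρ' → 0 < C →
      (∀ c ∈ Icc c₀ c₁, Convex ℝ {x | f x ≤ c}) →
      (∀ c ∈ Icc c₀ c₁, {x | f x ≤ c} ⊆ closure {x | f x < c}) →
      (∀ c ∈ Icc c₀ c₁, ∀ y ∈ D, c ≤ f y → ∃ x, f x = c ∧ ‖x - y‖ ≤ C * (f y - c)) →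
      (∀ c ∈ Icc c₀ c₁, ∀ x, f x = c → ball x ρ ⊆ D) →
      (∀ c ∈ Icc c₀ c₁, ∀ x, f x = c → ∀ k : E4 → β, P k (ball x ρ ∩ {y | f y < c}) →
        ∃ k' : E4 → β, P k' (ball x ρ') ∧ EqOn k' k (ball x ρ' ∩ {y | f y < c})) →
      P k₀ (D ∩ {y | f y < c₀}) →
      ∃ k : E4 → β, P k (D ∩ {y | f y < c₁}) ∧ EqOn k k₀ (D ∩ {y | f y < c₀}) := by
  intro β P f D c₀ c₁ ρ ρ' C k₀ hmono hcongr hunion hpatch hf hD hc hρ' hC hconv hdense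
    hcover hball hloc hk₀
  set σ : ℝ := ρ' / (2 * C) with hσ
  have hσpos : 0 < σ := by positivity
  -- `n` steps of size `σ` starting from `c₀`, as long as the level stays `≤ c₁`
  have key : ∀ n : ℕ, c₀ + n * σ ≤ c₁ →
      ∃ k : E4 → β, P k (D ∩ {y | f y < c₀ + (n + 1) * σ}) ∧ EqOn k k₀ (D ∩ {y | f y < c₀}) := by
    intro n
    induction n with
    | zero =>
      intro _
      have hc₀ : c₀ ∈ Icc c₀ c₁ := ⟨le_rfl, hc⟩
      obtain ⟨k, hk, hkeq⟩ := levelSweep_step β P f D c₀ ρ ρ' C hmono hcongr hunion hpatch hf hD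
        hρ' hC (hconv c₀ hc₀) (hdense c₀ hc₀) (hcover c₀ hc₀) (hball c₀ hc₀) (hloc c₀ hc₀)
        k₀ hk₀
      have e : c₀ + ((0 : ℕ) + 1 : ℝ) * σ = c₀ + ρ' / (2 * C) := by
        rw [hσ]; push_cast; ring
      rw [← e] at hk
      exact ⟨k, hk, hkeq⟩
    | succ n ih =>
      intro hn
      have hn' : c₀ + n * σ ≤ c₁ := by
        have : (n : ℝ) * σ ≤ ((n + 1 : ℕ) : ℝ) * σ := by
          push_cast
          nlinarith
        linarith
      obtain ⟨k, hk, hkeq⟩ := ih hn'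
      set c : ℝ := c₀ + (n + 1) * σ with hcdef
      have hcmem : c ∈ Icc c₀ c₁ := by
        refine ⟨?_, ?_⟩
        · rw [hcdef]
          have : (0 : ℝ) ≤ (n + 1) * σ := by positivity
          linarith
        · push_cast at hn
          rw [hcdef]
          exact hn
      obtain ⟨k', hk', hk'eq⟩ := levelSweep_step β P f D c ρ ρ' C hmono hcongr hunion hpatch hf hD
        hρ' hC (hconv c hcmem) (hdense c hcmem) (hcover c hcmem) (hball c hcmem) (hloc c hcmem)
        k hk
      refine ⟨k', ?_, fun y hy ↦ ?_⟩
      · have e : c₀ + ((n + 1 : ℕ) + 1 : ℝ) * σ = c + ρ' / (2 * C) := by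
          rw [hcdef, hσ]; push_cast; ring
        rw [← e] at hk'
        exact hk'
      · have hy' : y ∈ D ∩ {y | f y < c} := by
          refine ⟨hy.1, ?_⟩
          show f y < c
          have : f y < c₀ := hy.2
          rw [hcdef]
          have : (0 : ℝ) ≤ (n + 1) * σ := by positivity
          linarith
        rw [hk'eq hy', hkeq hy]
  -- take `n = ⌊(c₁ − c₀)/σ⌋`
  obtain ⟨n, hn₁, hn₂⟩ : ∃ n : ℕ, c₀ + n * σ ≤ c₁ ∧ c₁ ≤ c₀ + (n + 1) * σ := by
    refine ⟨⌊(c₁ - c₀) / σ⌋₊, ?_, ?_⟩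
    · have h1 : (⌊(c₁ - c₀) / σ⌋₊ : ℝ) ≤ (c₁ - c₀) / σ :=
        Nat.floor_le (div_nonneg (sub_nonneg.2 hc) hσpos.le)
      have h2 : (⌊(c₁ - c₀) / σ⌋₊ : ℝ) * σ ≤ c₁ - c₀ := by
        rwa [le_div_iff₀ hσpos] at h1
      linarith
    · have h1 : (c₁ - c₀) / σ < ⌊(c₁ - c₀) / σ⌋₊ + 1 := Nat.lt_floor_add_one _
      have h2 : c₁ - c₀ < (⌊(c₁ - c₀) / σ⌋₊ + 1) * σ := by
        rwa [div_lt_iff₀ hσpos] at h1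
      linarith
  obtain ⟨k, hk, hkeq⟩ := key n hn₁
  exact ⟨k, hmono _ _ _ hk fun y hy ↦ ⟨hy.1, lt_of_lt_of_le hy.2 hn₂⟩, hkeq⟩

end Summit.FinalStateConjecture.FinalStateConjecture.Theorems

end
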